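import Mathlib.Combinatorics.SetFamily.FourFunctions
import Mathlib.Order.Preorder.Finite
import Mathlib.Tactic
import HarnessLib
import HarnessLib.Audit.Tags
import Summits.CriticalPhenomena.PercolationContinuityZ3.Theorems.PercNearOneGluingNoHeavyLowerTailSahiColouredDaykin
import Summits.CriticalPhenomena.PercolationContinuityZ3.Theorems.PercNearOneGluingNoHeavyLowerTailSahiColouredDaykinCross
import Summits.CriticalPhenomena.PercolationContinuityZ3.Theorems.PercNearOneGluingNoHeavyLowerTailSahiColouredDaykinBrualdi

/-!
# Crossing signed coloured Daykin: the typed Brualdi–Ryser step, the induction, and two corollaries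

Support file (seat `prim-masterthm-p1`, gen 32; `--supports stmt-CriticalPhenomena-4575`).  Pure theorems over `…SahiColouredDaykinBrualdi`; no `sorry`,
standard axioms.  Memo `run/shared/lean/prim/prim-masterthm/FROM-prim-masterthm-p1-g32-TYPED-BRUALDI.md` §2.

THE STEP (Brualdi–Ryser's induction-on-the-number-of-sets proof of Marica–Schönheim [*Combinatorial Matrix Theory* (1991) Thm 9.3.3], transplanted to
typed differences; [this work]).  Fix an inclusion-minimal admissible intersection `E` of a crossing configuration `P`, let `T = brualdiSet F P c E`.
* THEOREM B (`dangerous_of_cand_mem`): if the candidate of some `p ∈ T` is still an admissible difference of `P \ T`, then `E` is `Dangerous`: there is a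
  RAINBOW triple `(p, q, w)` with `q ∪ w = (F \ p) ∪ E` (so `p ∪ q ∪ w = F`) or `q ∩ w = (F \ p) \ E` (so `p ∩ q ∩ w = ∅`).  The proof is Brualdi–Ryser's privacy
  argument ("every other member meets `X \ E`", here: inclusion-minimality of `E` forces the offending member into `T`) run through the 2 × 3 typed cases; only
  the cross-colour co-join (resp. meet) of two members of the two OTHER colours survives.
* `card_step`: if `E` is not dangerous, `#admDiffs (P \ T) + #T ≤ #admDiffs P`.
* `card_le_card_admDiffs_of_safe`: induction on `#P`.
* **THEOREM `card_le_card_compatJoins_of_threeWise`: `#P ≤ #compatJoins` (the conclusion of `CrossSignedColouredDaykin3`) for every crossing configuration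
  that is rainbow-3-wise intersecting and rainbow-3-wise non-covering** — no rainbow triple can be dangerous.  With at most two colours nothing is rainbow,
  so this contains the two-colour case (Marica–Schönheim for `P₀ ∪ (F \ P₁)`) with Brualdi–Ryser's proof.
* `crossSignedColouredDaykin3_of_lfCrude`: the typed conjecture `LFCrude` implies `CrossSignedColouredDaykin3`.
EVIDENCE for `LFCrude` (memo §3, engines `prim-masterthm-p1/code-g32/`): all 1 720 crossing three-colour configurations of `2^5`, ≈ 7 000 random ones of
`2^6`–`2^{10}`, imbalanced and product-structured configurations, the block families in both orientations, the MJ and Z-selector counterexamples: a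
non-dangerous inclusion-minimal `E` always exists (no simple selection rule is universal).  HONEST FRAMING: one unconditional partial result, one reduction;
`CrossSignedColouredDaykin3` remains OPEN. [this work]
-/

namespace Summit.CriticalPhenomena.PercolationContinuityZ3.Theorems.SahiColouredDaykin

open Finset
open scoped FinsetFamily

variable {α : Type*} [DecidableEq α]

section step
variable {F : Finset α} {P : Finset (Finset α)} {c : Finset α → Fin 3} {E : Finset α}

/-- **THEOREM B (leak structure).**  If `E` is an inclusion-minimal admissible intersection of the crossing configuration `P`, `p ∈ T(E)`, and the
candidate of `p` is still an admissible difference of `P \ T(E)`, then `E` is dangerous.  (Brualdi–Ryser's privacy argument plus the typed case analysis of the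
memo, §2.) [this work] -/
theorem dangerous_of_cand_mem (hP : IsCrossing F P c) (hEI : E ∈ admInters F P c)
    (hmin : ∀ G ∈ admInters F P c, G ⊆ E → G = E) {p : Finset α} (hp : p ∈ brualdiSet F P c E)
    (hcand : cand F E p ∈ admDiffs F (P \ brualdiSet F P c E) c) : Dangerous F P c E := by
  set T := brualdiSet F P c E with hT
  have hEne : E.Nonempty := nonempty_of_mem_admInters hP hEI
  obtain ⟨hpP, hpos | hneg⟩ := mem_brualdiSet.1 hp
  · -- positive side: `E ⊆ p`, candidate `p \ E`
    obtain ⟨hEp, _⟩ := hpos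
    have hcandeq : cand F E p = p \ E := by simp [cand, hEp]
    rw [hcandeq] at hcand
    rcases mem_admDiffs_iff.1 hcand with ⟨a, ha, b, hb, hab, heq⟩ | ⟨a, ha, b, hb, hab, heq⟩ | ⟨a, ha, b, hb, hab, heq⟩
    · -- (1) `p \ E = a \ b`, same colour
      obtain ⟨haP, haT⟩ := mem_sdiff.1 ha
      obtain ⟨hbP, hbT⟩ := mem_sdiff.1 hb
      by_cases hcb : c p = c b
      · -- `b ∩ p = E` forces `b ∈ T`
        have h1 : b ∩ p ⊆ E := by
          intro x hx
          obtain ⟨hxb, hxp⟩ := mem_inter.1 hx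
          by_contra hxE
          have : x ∈ a \ b := by rw [← heq]; exact mem_sdiff.2 ⟨hxp, hxE⟩
          exact (mem_sdiff.1 this).2 hxb
        have hne : p ≠ b := fun h => hbT (h ▸ hp)
        have h2 : b ∩ p = E := hmin _ (inter_mem_admInters hbP hpP (by rw [hcb]) (Ne.symm hne)) h1
        exact absurd (mem_brualdiSet_pos_same hbP hpP hcb hne hEp h2) hbT
      · -- `p \ a = E` forces `a ∈ T`
        have hca : c p ≠ c a := by rw [hab]; exact hcb
        have h1 : p \ a ⊆ E := by
          intro x hx
          obtain ⟨hxp, hxa⟩ := mem_sdiff.1 hx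
          by_contra hxE
          have : x ∈ a \ b := by rw [← heq]; exact mem_sdiff.2 ⟨hxp, hxE⟩
          exact hxa (mem_sdiff.1 this).1
        have h2 : p \ a = E := hmin _ (sdiff_mem_admInters hpP haP hca) h1
        exact absurd (mem_brualdiSet_neg_cross hP haP hpP hca hEp h2) haT
    · -- (2) `p \ E = a ∩ b`, different colours: impossible
      obtain ⟨haP, haT⟩ := mem_sdiff.1 ha
      obtain ⟨hbP, hbT⟩ := mem_sdiff.1 hb
      have key : ∀ {d : Finset α}, d ∈ P → d ∉ T → c p ≠ c d → p \ E ⊆ d → False := by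
        intro d hdP hdT hcd hsub
        have h1 : p \ d ⊆ E := by
          intro x hx
          obtain ⟨hxp, hxd⟩ := mem_sdiff.1 hx
          by_contra hxE
          exact hxd (hsub (mem_sdiff.2 ⟨hxp, hxE⟩))
        have h2 : p \ d = E := hmin _ (sdiff_mem_admInters hpP hdP hcd) h1
        exact hdT (mem_brualdiSet_neg_cross hP hdP hpP hcd hEp h2)
      by_cases hcb : c p = c b
      · have hca : c p ≠ c a := by rw [hcb]; exact Ne.symm hab
        exact (key haP haT hca (by rw [heq]; exact inter_subset_left)).elim
      · exact (key hbP hbT hcb (by rw [heq]; exact inter_subset_right)).elim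
    · -- (3) `p \ E = F \ (a ∪ b)`, different colours: dangerous unless `a` or `b` has the colour of `p`
      obtain ⟨haP, haT⟩ := mem_sdiff.1 ha
      obtain ⟨hbP, hbT⟩ := mem_sdiff.1 hb
      have key : ∀ {d : Finset α}, d ∈ P → d ∉ T → c p = c d → d ⊆ a ∪ b → False := by
        intro d hdP hdT hcd hsub
        have h1 : d ∩ p ⊆ E := by
          intro x hx
          obtain ⟨hxd, hxp⟩ := mem_inter.1 hx
          by_contra hxE
          have : x ∈ F \ (a ∪ b) := by rw [← heq]; exact mem_sdiff.2 ⟨hxp, hxE⟩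
          exact (mem_sdiff.1 this).2 (hsub hxd)
        have hne : p ≠ d := fun h => hdT (h ▸ hp)
        have h2 : d ∩ p = E := hmin _ (inter_mem_admInters hdP hpP (by rw [hcd]) (Ne.symm hne)) h1
        exact hdT (mem_brualdiSet_pos_same hdP hpP hcd hne hEp h2)
      by_cases hca : c p = c a
      · exact (key haP haT hca subset_union_left).elim
      by_cases hcb : c p = c b
      · exact (key hbP hbT hcb subset_union_right).elim
      refine ⟨p, hpP, a, haP, b, hbP, hca, hcb, hab, Or.inl ⟨hEp, ?_⟩⟩
      -- `a ∪ b = (F \ p) ∪ E`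
      have hpF := hP.subset p hpP
      have haF := hP.subset a haP
      have hbF := hP.subset b hbP
      ext x
      have hx1 : x ∈ p \ E ↔ x ∈ F \ (a ∪ b) := by rw [heq]
      simp only [mem_sdiff, mem_union] at hx1 ⊢
      constructor
      · intro hx
        have hxF : x ∈ F := hx.elim (fun h => haF h) (fun h => hbF h)
        by_cases hxp : x ∈ p
        · right; by_contra hxE; exact ((hx1.1 ⟨hxp, hxE⟩).2) hx
        · exact Or.inl ⟨hxF, hxp⟩
      · rintro (⟨hxF, hxp⟩ | hxE)
        · by_contra hx; exact hxp (hx1.2 ⟨hxF, hx⟩).1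
        · by_contra hx; exact (hx1.2 ⟨hpF (hEp hxE), hx⟩).2 hxE
  · -- negative side: `E ⊆ F \ p`, candidate `(F \ p) \ E`
    obtain ⟨hEFp, _⟩ := hneg
    have hnEp : ¬ E ⊆ p := by
      intro h
      obtain ⟨x, hx⟩ := hEne
      exact (mem_sdiff.1 (hEFp hx)).2 (h hx)
    have hcandeq : cand F E p = (F \ p) \ E := by simp [cand, hnEp]
    rw [hcandeq] at hcand
    have hpF := hP.subset p hpP
    rcases mem_admDiffs_iff.1 hcand with ⟨a, ha, b, hb, hab, heq⟩ | ⟨a, ha, b, hb, hab, heq⟩ | ⟨a, ha, b, hb, hab, heq⟩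
    · -- (1') `(F \ p) \ E = a \ b`, same colour
      obtain ⟨haP, haT⟩ := mem_sdiff.1 ha
      obtain ⟨hbP, hbT⟩ := mem_sdiff.1 hb
      by_cases hcb : c p = c b
      · -- then `c p = c a`: `F \ (a ∪ p) = E` forces `a ∈ T`
        have hca : c p = c a := by rw [hab]; exact hcb
        have h1 : F \ (a ∪ p) ⊆ E := by
          intro x hx
          obtain ⟨hxF, hxap⟩ := mem_sdiff.1 hx
          rw [mem_union, not_or] at hxap
          by_contra hxE
          have : x ∈ a \ b := by rw [← heq]; exact mem_sdiff.2 ⟨mem_sdiff.2 ⟨hxF, hxap.2⟩, hxE⟩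
          exact hxap.1 (mem_sdiff.1 this).1
        have hne : p ≠ a := fun h => haT (h ▸ hp)
        have h2 : F \ (a ∪ p) = E := hmin _ (sdiff_union_mem_admInters haP hpP (by rw [hca]) (Ne.symm hne)) h1
        exact absurd (mem_brualdiSet_neg_same haP hpP hca hne hEFp h2) haT
      · -- `b \ p = E` forces `b ∈ T`
        have h1 : b \ p ⊆ E := by
          intro x hx
          obtain ⟨hxb, hxp⟩ := mem_sdiff.1 hx
          by_contra hxE
          have : x ∈ a \ b := by rw [← heq]; exact mem_sdiff.2 ⟨mem_sdiff.2 ⟨hP.subset b hbP hxb, hxp⟩, hxE⟩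
          exact (mem_sdiff.1 this).2 hxb
        have h2 : b \ p = E := hmin _ (sdiff_mem_admInters hbP hpP (Ne.symm hcb)) h1
        exact absurd (mem_brualdiSet_pos_cross hbP hpP hcb hEFp h2) hbT
    · -- (2') `(F \ p) \ E = a ∩ b`, different colours: dangerous unless `a` or `b` has the colour of `p`
      obtain ⟨haP, haT⟩ := mem_sdiff.1 ha
      obtain ⟨hbP, hbT⟩ := mem_sdiff.1 hb
      have key : ∀ {d : Finset α}, d ∈ P → d ∉ T → c p = c d → a ∩ b ⊆ d → False := by
        intro d hdP hdT hcd hsub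
        have h1 : F \ (d ∪ p) ⊆ E := by
          intro x hx
          obtain ⟨hxF, hxdp⟩ := mem_sdiff.1 hx
          rw [mem_union, not_or] at hxdp
          by_contra hxE
          have : x ∈ a ∩ b := by rw [← heq]; exact mem_sdiff.2 ⟨mem_sdiff.2 ⟨hxF, hxdp.2⟩, hxE⟩
          exact hxdp.1 (hsub this)
        have hne : p ≠ d := fun h => hdT (h ▸ hp)
        have h2 : F \ (d ∪ p) = E := hmin _ (sdiff_union_mem_admInters hdP hpP (by rw [hcd]) (Ne.symm hne)) h1
        exact hdT (mem_brualdiSet_neg_same hdP hpP hcd hne hEFp h2)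
      by_cases hca : c p = c a
      · exact (key haP haT hca inter_subset_left).elim
      by_cases hcb : c p = c b
      · exact (key hbP hbT hcb inter_subset_right).elim
      exact ⟨p, hpP, a, haP, b, hbP, hca, hcb, hab, Or.inr ⟨hEFp, heq.symm⟩⟩
    · -- (3') `(F \ p) \ E = F \ (a ∪ b)`, different colours: impossible
      obtain ⟨haP, haT⟩ := mem_sdiff.1 ha
      obtain ⟨hbP, hbT⟩ := mem_sdiff.1 hb
      have key : ∀ {d : Finset α}, d ∈ P → d ∉ T → c p ≠ c d → d ⊆ a ∪ b → False := by
        intro d hdP hdT hcd hsub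
        have h1 : d \ p ⊆ E := by
          intro x hx
          obtain ⟨hxd, hxp⟩ := mem_sdiff.1 hx
          by_contra hxE
          have : x ∈ F \ (a ∪ b) := by rw [← heq]; exact mem_sdiff.2 ⟨mem_sdiff.2 ⟨hP.subset d hdP hxd, hxp⟩, hxE⟩
          exact (mem_sdiff.1 this).2 (hsub hxd)
        have h2 : d \ p = E := hmin _ (sdiff_mem_admInters hdP hpP (Ne.symm hcd)) h1
        exact hdT (mem_brualdiSet_pos_cross hdP hpP hcd hEFp h2)
      by_cases hcb : c p = c b
      · have hca : c p ≠ c a := by rw [hcb]; exact Ne.symm hab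
        exact (key haP haT hca subset_union_left).elim
      · exact (key hbP hbT hcb subset_union_right).elim


/-- **The step.**  For an inclusion-minimal, non-dangerous admissible intersection `E`:
`#admDiffs (P \ T(E)) + #T(E) ≤ #admDiffs P`. [this work] -/
theorem card_step (hP : IsCrossing F P c) (hEI : E ∈ admInters F P c) (hmin : ∀ G ∈ admInters F P c, G ⊆ E → G = E)
    (hsafe : ¬ Dangerous F P c E) :
    #(admDiffs F (P \ brualdiSet F P c E) c) + #(brualdiSet F P c E) ≤ #(admDiffs F P c) := by
  set T := brualdiSet F P c E with hT
  have hdisj : Disjoint (admDiffs F (P \ T) c) (T.image (cand F E)) := by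
    rw [disjoint_left]
    intro Z hZ hZ'
    obtain ⟨p, hp, rfl⟩ := mem_image.1 hZ'
    exact hsafe (dangerous_of_cand_mem hP hEI hmin hp hZ)
  have hsub : admDiffs F (P \ T) c ∪ T.image (cand F E) ⊆ admDiffs F P c := by
    apply union_subset (admDiffs_mono sdiff_subset)
    intro Z hZ
    obtain ⟨p, hp, rfl⟩ := mem_image.1 hZ
    exact cand_mem_admDiffs hP hp
  calc #(admDiffs F (P \ T) c) + #T = #(admDiffs F (P \ T) c) + #(T.image (cand F E)) := by rw [card_image_of_injOn (cand_injOn hP)]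
    _ = #(admDiffs F (P \ T) c ∪ T.image (cand F E)) := (card_union_of_disjoint hdisj).symm
    _ ≤ #(admDiffs F P c) := card_le_card hsub

end step

/-! ### The induction and its two corollaries -/

section induction
variable {F : Finset α} {c : Finset α → Fin 3}

/-- **Typed Brualdi–Ryser induction.**  If every crossing sub-configuration with at least two members admits an inclusion-minimal admissible
intersection that is not dangerous, then `#P ≤ #admDiffs`. [this work] -/
theorem card_le_card_admDiffs_of_safe {P : Finset (Finset α)} (hP : IsCrossing F P c)
    (hsafe : ∀ P' ⊆ P, 2 ≤ #P' → ∃ E ∈ admInters F P' c, (∀ G ∈ admInters F P' c, G ⊆ E → G = E) ∧ ¬ Dangerous F P' c E) :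
    #P ≤ #(admDiffs F P c) := by
  -- strong induction on `#P`
  suffices h : ∀ n, ∀ Q ⊆ P, #Q = n → #Q ≤ #(admDiffs F Q c) from h #P P Subset.rfl rfl
  intro n
  induction n using Nat.strong_induction_on with
  | _ n ih =>
    intro Q hQP hQn
    have hQ : IsCrossing F Q c := hP.mono hQP
    rcases Nat.lt_or_ge n 2 with hlt | hge
    · -- `#Q ≤ 1`
      rcases Nat.lt_or_ge n 1 with h0 | h1
      · omega
      · have hQ1 : #Q = 1 := by omega
        obtain ⟨p, hp⟩ := Finset.card_eq_one.1 hQ1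
        have hpQ : p ∈ Q := by rw [hp]; exact mem_singleton_self p
        have : p \ p ∈ admDiffs F Q c := sdiff_mem_admDiffs hpQ hpQ rfl
        rw [hQn, ← hQ1.symm.trans hQn]  -- goal: 1 ≤ #admDiffs
        · exact Finset.one_le_card.2 ⟨_, this⟩
    · obtain ⟨E, hEI, hmin, hsafeE⟩ := hsafe Q hQP (hQn ▸ hge)
      have hstep := card_step hQ hEI hmin hsafeE
      have hT := brualdiSet_nonempty hQ hEI
      have hTsub : brualdiSet F Q c E ⊆ Q := brualdiSet_subset
      have hlt : #(Q \ brualdiSet F Q c E) < n := by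
        rw [← hQn, card_sdiff_of_subset hTsub]
        have := Finset.card_pos.2 hT
        have := card_le_card hTsub
        omega
      have hIH := ih _ hlt (Q \ brualdiSet F Q c E) (sdiff_subset.trans hQP) rfl
      have hsplit : #Q = #(Q \ brualdiSet F Q c E) + #(brualdiSet F Q c E) := (card_sdiff_add_card_eq_card hTsub).symm
      omega

/-- **THEOREM (3-wise crossing ⟹ CROSS-SCD₃).**  If in addition to crossing every rainbow triple has a common point and does not cover `F`, then
the compatible unions are at least as numerous as `P`. [this work] -/
theorem card_le_card_compatJoins_of_threeWise (P : Finset (Finset α)) (hPF : ∀ S ∈ P, S ⊆ F)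
    (hinc : ∀ S ∈ P, ∀ T ∈ P, c S ≠ c T → ¬ S ⊆ T) (hcross : ∀ S ∈ P, ∀ T ∈ P, (S ∩ T).Nonempty ∧ S ∪ T ≠ F)
    (h3 : ∀ p ∈ P, ∀ q ∈ P, ∀ w ∈ P, c p ≠ c q → c p ≠ c w → c q ≠ c w → (p ∩ q ∩ w).Nonempty ∧ p ∪ q ∪ w ≠ F) :
    #P ≤ #(compatJoins F P c) := by
  have hP : IsCrossing F P c := ⟨hPF, hinc, hcross⟩
  refine le_trans (card_le_card_admDiffs_of_safe hP ?_) (card_admDiffs_le_card_compatJoins hPF)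
  intro P' hP' h2
  obtain ⟨E, hEI, hmin⟩ := exists_minimal_admInters (F := F) (c := c) h2
  refine ⟨E, hEI, hmin, ?_⟩
  rintro ⟨p, hp, q, hq, w, hw, hpq, hpw, hqw, ⟨hEp, h⟩ | ⟨hEFp, h⟩⟩
  · -- covering triple
    have hpF := hPF p (hP' hp)
    refine (h3 p (hP' hp) q (hP' hq) w (hP' hw) hpq hpw hqw).2 ?_
    apply Subset.antisymm (union_subset (union_subset hpF (hPF q (hP' hq))) (hPF w (hP' hw)))
    intro x hx
    by_cases hxp : x ∈ p
    · exact mem_union.2 (Or.inl (mem_union.2 (Or.inl hxp)))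
    · have : x ∈ q ∪ w := by rw [h]; exact mem_union.2 (Or.inl (mem_sdiff.2 ⟨hx, hxp⟩))
      rw [union_assoc]; exact mem_union.2 (Or.inr this)
  · -- empty triple
    obtain ⟨x, hx⟩ := (h3 p (hP' hp) q (hP' hq) w (hP' hw) hpq hpw hqw).1
    rw [inter_assoc, mem_inter, h, mem_sdiff, mem_sdiff] at hx
    exact hx.2.1.2 hx.1

/-- **LF-crude ⟹ `CrossSignedColouredDaykin3`.** [this work] -/
theorem crossSignedColouredDaykin3_of_lfCrude (h : LFCrude α) : CrossSignedColouredDaykin3 α := by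
  intro F P c hPF hinc hcross
  have hP : IsCrossing F P c := ⟨hPF, hinc, hcross⟩
  refine le_trans (card_le_card_admDiffs_of_safe hP ?_) (card_admDiffs_le_card_compatJoins hPF)
  intro P' hP' h2
  have hP'c := hP.mono hP'
  by_cases hall : ∀ i : Fin 3, ∃ p ∈ P', c p = i
  · exact h F P' c hP'c.subset hP'c.incomp hP'c.cross hall
  · have hall' : ∃ i : Fin 3, ∀ p ∈ P', c p ≠ i := by
      by_contra hcon
      apply hall
      intro i
      by_contra hi
      exact hcon ⟨i, fun p hp hci => hi ⟨p, hp, hci⟩⟩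
    obtain ⟨i, hi⟩ := hall'
    obtain ⟨E, hEI, hmin⟩ := exists_minimal_admInters (F := F) (c := c) h2
    exact ⟨E, hEI, hmin, not_dangerous_of_missing_colour i hi⟩

end induction

end Summit.CriticalPhenomena.PercolationContinuityZ3.Theorems.SahiColouredDaykin
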